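import Literature.Barriers.CriticalPhenomena.TimarEncounterPoints
import Literature.Barriers.CriticalPhenomena.TimarBadClusters
import Literature.Barriers.CriticalPhenomena.TimarParentChains
import Literature.Barriers.CriticalPhenomena.TimarCriticalNonunimodular
import HarnessLib

/-!
# Local surgery in a ball: cluster structure after closing a ball and opening a tree — the
# deterministic part of "the existence of encounter points follows from insertion tolerance"
# (Timár 2006, §5, Lemma 5.3 / proof of Thm. 5.5) — PROVED

Barrier catalogue `Literature/Barriers/CriticalPhenomena/`; a deterministic brick of the
programme proving Timár's Thm. 5.5 (`Timar2006_finiteLevelUnion`,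
`TimarCriticalNonunimodular.lean`). The proof of Thm. 5.5 starts a forest on the encounter points
of the *bad* clusters (heavy clusters all of whose pieces inside finite unions of levels are
finite), which requires that bad clusters have encounter points with positive probability. The
standard local modification (Lyons–Peres 2016, proof of Thm. 7.6; Burton–Keane) is: in a ball
`K = B(o, r)` close every edge touching `K` and open a tree `T` inside `K ∪ ∂K` joining `o` to
chosen vertices of the sphere `∂K = {d(o, ·) = r + 1}`. This file analyses the resulting
configuration `surgery G o r T ω = (ω ∖ E_K) ∪ T` for `ω ⊆ E(G)`:

* `ballVerts`, `sphereVerts`, `ballEdges` (`= edgesAt` of the ball), `prunedConfig = ω ∖ E_K`;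
* **the new cluster of `o`** is `VT ∪ ⋃_{a ∈ VT ∩ ∂K} C_{ω∖E_K}(a)`
  (`openCluster_surgery_base`), for a tree `T ⊆ E(G)` with vertex set `VT ⊆ K ∪ ∂K`, `o ∈ VT`,
  `VT` joined to `o` by `T`;
* **the other clusters are clusters of `ω ∖ E_K`** (`openCluster_surgery_of_not_mem`), and a
  cluster of `ω ∖ E_K` off `K` containing no sphere vertex is an unchanged cluster of `ω` missing
  `K` (`openCluster_prunedConfig_eq`);
* **bad clusters** (`IsBad`: heavy and `LevelBad` (`TimarBadClusters.lean`) — every piece in a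
  finite union of levels finite, the negation of the conclusion of Thm. 5.5) are local
  (`isBad_congr`), transported by automorphisms (`isBad_relabel_iff`) and measurable
  (`measurableSet_isBad`);
* **(S1) absorbing surgery** (`not_isBad_surgery`): if `VT` contains every sphere vertex whose
  `ω ∖ E_K`-cluster is heavy, every bad `ω`-cluster meets `K`, and the new cluster of `o` is not
  bad, then the new configuration has NO bad cluster; and the new cluster of `o` is indeed not bad
  as soon as some heavy cluster with an infinite level-piece meets `K` (`not_isBad_surgery_base`);
* **(S2) tripod surgery** (`isBad_surgery_tripod`, `isEncounter_surgery_tripod`): if `T` is the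
  tripod of three sphere vertices `a b c` whose `ω ∖ E_K`-clusters are heavy, pairwise distinct
  and contained in bad `ω`-clusters, then the new cluster of `o` is bad and the median `m` of
  `TimarParentChains.lean` is an encounter point of it.

## References

* Á. Timár, Ann. Probab. 34 (2006) 2344–2364 (arXiv:math/0702875), §5: Lemma 5.3 ("follows
  from insertion tolerance"), Thm. 5.5 (proof, first paragraph: the subgraph `ω` of bad clusters).
  [Timar2006]
* R. Lyons, Y. Peres, *Probability on Trees and Networks*, CUP 2016, proof of Thm. 7.6.
  [LyonsPeres2016]
-/

noncomputable section

namespace Literature.Barriers.CriticalPhenomena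

open _root_.MeasureTheory Literature.Probability.LatticeModels Literature.Probability.Percolation SimpleGraph
open scoped ENNReal

variable {V : Type*}

/-! ### Locality of clusters and pieces -/

/-- **Clusters only see the edges at their own vertices**: if every open edge of `ω₁` at a vertex
of `C_{ω₁}(x)` is open in `ω₂`, then `C_{ω₁}(x) ⊆ C_{ω₂}(x)`. [folklore] -/
theorem openCluster_subset_of_edges {ω₁ ω₂ : BondConfig V} {x : V}
    (h : ∀ a ∈ openCluster ω₁ x, ∀ b, s(a, b) ∈ ω₁ → a ≠ b → s(a, b) ∈ ω₂) :
    openCluster ω₁ x ⊆ openCluster ω₂ x :=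
  openCluster_subset_of_forall_mem' (mem_openCluster_self ω₂ x) fun a b ha haS hab hne =>
    mem_openCluster_of_adj haS (h a ha b hab hne) hne

/-- The piece of `y` inside the finite union `L` of levels: the open cluster of `y` for the steps
of `G` inside `levelUnion G S` (as in `Timar2006_finiteLevelUnion`). [cite: Timar2006, Thm. 5.5 (statement: L ∩ C)] -/
abbrev levelPiece (G : SimpleGraph V) (S : Finset V) (ω : BondConfig V) (y : V) : Set V :=
  openClusterIn (withinGraph G (levelUnion G S)) ω y

/-- **Pieces are local**: if `C_{ω₁}(y) = C_{ω₂}(y)` and `ω₁, ω₂` have the same edges at the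
vertices of this cluster, the level-pieces of `y` agree. [folklore] -/
theorem levelPiece_subset_of_edges (G : SimpleGraph V) (S : Finset V) {ω₁ ω₂ : BondConfig V} {y : V}
    (h : ∀ a ∈ openCluster ω₁ y, ∀ b, s(a, b) ∈ ω₁ → a ≠ b → s(a, b) ∈ ω₂) :
    levelPiece G S ω₁ y ⊆ levelPiece G S ω₂ y := by
  refine openCluster_subset_of_edges fun a ha b hab hne => ?_
  refine ⟨h a (openClusterIn_subset_openCluster _ _ _ ha) b hab.1 hne, hab.2⟩

/-! ### Bad clusters -/

/-- **`C(x)` is a bad cluster**: heavy, and every piece of it inside every finite union of levels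
is finite — the clusters Thm. 5.5 excludes ("Suppose that for some heavy cluster `C` and any `L`
that is a finite union of levels, all connected components in `C ∩ L` are finite. Let `ω` be the
subgraph consisting of these `C`'s", Timár 2006, proof of Thm. 5.5).
[cite: Timar2006, Thm. 5.5 (proof, first paragraph)] -/
def IsBad (G : SimpleGraph V) (o : V) (ω : BondConfig V) (x : V) : Prop :=
  IsHeavy G o (openCluster ω x) ∧ LevelBad G ω x

/-- Unfolding: heavy, and every level-piece of every vertex of `C(x)` is finite (`LevelBad`,
`TimarBadClusters.lean`). [folklore] -/
theorem isBad_iff {G : SimpleGraph V} {o : V} {ω : BondConfig V} {x : V} :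
    IsBad G o ω x ↔ IsHeavy G o (openCluster ω x) ∧
      ∀ (S : Finset V) (y : V), y ∈ openCluster ω x → (levelPiece G S ω y).Finite := Iff.rfl

/-- Badness is a property of the cluster. [folklore] -/
theorem isBad_of_mem {G : SimpleGraph V} {o : V} {ω : BondConfig V} {x y : V}
    (hy : y ∈ openCluster ω x) : IsBad G o ω y ↔ IsBad G o ω x := by
  unfold IsBad
  rw [openCluster_eq_openCluster_of_mem hy, levelBad_iff_of_mem hy]

/-- **Badness is local**: configurations with the same cluster at `x` and the same edges at its
vertices have the same badness at `x`. [folklore] -/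
theorem isBad_congr {G : SimpleGraph V} {o : V} {ω₁ ω₂ : BondConfig V} {x : V}
    (h : ∀ a ∈ openCluster ω₁ x, ∀ b, a ≠ b → (s(a, b) ∈ ω₁ ↔ s(a, b) ∈ ω₂)) :
    IsBad G o ω₁ x ↔ IsBad G o ω₂ x := by
  have h12 : openCluster ω₁ x ⊆ openCluster ω₂ x :=
    openCluster_subset_of_edges fun a ha b hab hne => (h a ha b hne).1 hab
  have hC : openCluster ω₁ x = openCluster ω₂ x := by
    refine Set.Subset.antisymm h12 (openCluster_subset_of_forall_mem' (mem_openCluster_self ω₁ x) ?_)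
    intro a b _ haS hab hne
    exact mem_openCluster_of_adj haS ((h a haS b hne).2 hab) hne
  have hpiece : ∀ S y, y ∈ openCluster ω₁ x → levelPiece G S ω₁ y = levelPiece G S ω₂ y := by
    intro S y hy
    have hy₁ : openCluster ω₁ y = openCluster ω₁ x := openCluster_eq_openCluster_of_mem hy
    have hy₂ : openCluster ω₂ y = openCluster ω₂ x := openCluster_eq_openCluster_of_mem (hC ▸ hy)
    refine Set.Subset.antisymm (levelPiece_subset_of_edges G S fun a ha b hab hne => ?_)
      (levelPiece_subset_of_edges G S fun a ha b hab hne => ?_)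
    · exact (h a (hy₁ ▸ ha) b hne).1 hab
    · exact (h a (hC.symm ▸ hy₂ ▸ ha) b hne).2 hab
  unfold IsBad LevelBad
  rw [hC]
  refine and_congr_right fun _ => forall_congr' fun S => forall_congr' fun y => ?_
  exact imp_congr_right fun hy => by
    have hp := hpiece S y (hC.symm ▸ hy)
    simp only [levelPiece] at hp
    rw [hp]

/-- Light clusters are not bad. [folklore] -/
theorem not_isBad_of_not_isHeavy {G : SimpleGraph V} {o : V} {ω : BondConfig V} {x : V}
    (h : ¬ IsHeavy G o (openCluster ω x)) : ¬ IsBad G o ω x := fun hb => h hb.1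

/-- A cluster with an infinite level-piece ("good") is not bad. [folklore] -/
theorem not_isBad_of_infinite_levelPiece {G : SimpleGraph V} {o : V} {ω : BondConfig V} {x y : V}
    (hy : y ∈ openCluster ω x) {S : Finset V} (h : (levelPiece G S ω y).Infinite) : ¬ IsBad G o ω x :=
  fun hb => h (hb.2 S y hy)

/-! ### Bad clusters under automorphisms; measurability -/

/-- **Bad clusters are transported by automorphisms** (`isHeavy_image_iff` and
`levelBad_relabel_iff`). [folklore] -/
theorem isBad_relabel_iff (G : SimpleGraph V) [G.LocallyFinite] (hconn : G.Connected)
    (γ : G ≃g G) (o : V) (ω : BondConfig V) (x : V) :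
    IsBad G o (BondConfig.relabel (sym2Equiv γ.toEquiv) ω) (γ x) ↔ IsBad G o ω x := by
  have hC : openCluster (BondConfig.relabel (sym2Equiv γ.toEquiv) ω) (γ x) = (γ : V → V) '' openCluster ω x :=
    openCluster_relabel γ.toEquiv ω x
  unfold IsBad
  rw [hC, isHeavy_image_iff G hconn γ o, levelBad_relabel_iff γ ω x]

/-- **`{C(x) is bad}` is measurable** (`V` countable; `measurableSet_isHeavy_and_levelBad`).
[folklore] -/
theorem measurableSet_isBad [Countable V] (G : SimpleGraph V) (o x : V) :
    MeasurableSet {ω : BondConfig V | IsBad G o ω x} :=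
  measurableSet_isHeavy_and_levelBad G o x

/-! ### The ball, the sphere, pruning and surgery -/

section Ball

variable (G : SimpleGraph V) [G.LocallyFinite] (o : V) (r : ℕ)

/-- The ball `K = B(o, r)` as a finite set. [folklore] -/
def ballVerts : Finset V := (graphBall_finite G o r).toFinset

/-- The sphere `∂K = {v : d(o, v) = r + 1}`. [folklore] -/
def sphereVerts : Set V := {v | G.dist o v = r + 1}

variable [DecidableEq V]

/-- The edges of `G` touching the ball, `E_K`. [folklore] -/
def ballEdges : Finset (Sym2 V) := edgesAt G (ballVerts G o r)

/-- The pruned configuration `ω ∖ E_K`. [folklore] -/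
def prunedConfig (ω : BondConfig V) : BondConfig V := closeEdges ↑(ballEdges G o r) ω

/-- **The surgery**: close the edges touching the ball, then open the tree `T`.
[cite: Timar2006, Lemma 5.3 (proof: insertion tolerance)] -/
def surgery (T : Set (Sym2 V)) (ω : BondConfig V) : BondConfig V :=
  openEdges T (prunedConfig G o r ω)

variable {G o r}

omit [DecidableEq V] in
/-- Membership in the ball: `d(o, v) ≤ r` (`G` connected). [folklore] -/
theorem mem_ballVerts_iff (hconn : G.Connected) {v : V} : v ∈ ballVerts G o r ↔ G.dist o v ≤ r := by
  rw [ballVerts, Set.Finite.mem_toFinset]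
  constructor
  · rintro ⟨w, hw⟩
    exact (dist_le w).trans hw
  · intro h
    obtain ⟨w, hw⟩ := hconn.exists_walk_length_eq_dist o v
    exact ⟨w, hw ▸ h⟩

omit [DecidableEq V] in
/-- A neighbour of the ball outside the ball is on the sphere. [folklore] -/
theorem mem_sphereVerts_of_adj (hconn : G.Connected) {k v : V} (hk : k ∈ ballVerts G o r)
    (hv : v ∉ ballVerts G o r) (hadj : G.Adj k v) : v ∈ sphereVerts G o r := by
  rw [mem_ballVerts_iff hconn] at hk hv
  have h1 : G.dist o v ≤ G.dist o k + 1 := by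
    calc G.dist o v ≤ G.dist o k + G.dist k v := hconn.dist_triangle
      _ = G.dist o k + 1 := by rw [dist_eq_one_iff_adj.2 hadj]
  change G.dist o v = r + 1
  omega

omit [DecidableEq V] in
/-- Sphere vertices are not in the ball. [folklore] -/
theorem not_mem_ballVerts_of_mem_sphereVerts (hconn : G.Connected) {v : V}
    (hv : v ∈ sphereVerts G o r) : v ∉ ballVerts G o r := by
  rw [mem_ballVerts_iff hconn]
  change G.dist o v = r + 1 at hv
  omega

/-- The pruned configuration is a subconfiguration. [folklore] -/
theorem prunedConfig_subset (ω : BondConfig V) : prunedConfig G o r ω ⊆ ω := closeEdges_subset _ ω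

/-- The pruned configuration is contained in the surgery. [folklore] -/
theorem prunedConfig_subset_surgery (T : Set (Sym2 V)) (ω : BondConfig V) :
    prunedConfig G o r ω ⊆ surgery G o r T ω :=
  subset_openEdges T _

/-- The tree is open after the surgery. [folklore] -/
theorem subset_surgery (T : Set (Sym2 V)) (ω : BondConfig V) : T ⊆ surgery G o r T ω :=
  subset_openEdges_right T _

/-- Membership in the surgery. [folklore] -/
theorem mem_surgery_iff {T : Set (Sym2 V)} {ω : BondConfig V} {e : Sym2 V} :
    e ∈ surgery G o r T ω ↔ e ∈ prunedConfig G o r ω ∨ e ∈ T := by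
  rw [surgery, mem_openEdges]

/-- In the pruned configuration no open edge touches the ball (`ω ⊆ E(G)`). [folklore] -/
theorem not_mem_prunedConfig {ω : BondConfig V} (hω : ω ⊆ G.edgeSet) {k b : V}
    (hk : k ∈ ballVerts G o r) : s(k, b) ∉ prunedConfig G o r ω :=
  not_mem_closeEdges_edgesAt hω hk

/-- Open edges of `ω` off the ball survive the pruning. [folklore] -/
theorem mk_mem_prunedConfig {ω : BondConfig V} {a b : V} (hab : s(a, b) ∈ ω)
    (ha : a ∉ ballVerts G o r) (hb : b ∉ ballVerts G o r) : s(a, b) ∈ prunedConfig G o r ω :=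
  mk_mem_closeEdges_edgesAt hab ha hb

/-- Ball vertices are isolated after pruning: their pruned cluster is a singleton. [folklore] -/
theorem openCluster_prunedConfig_of_mem_ball {ω : BondConfig V} (hω : ω ⊆ G.edgeSet) {k : V}
    (hk : k ∈ ballVerts G o r) : openCluster (prunedConfig G o r ω) k = {k} :=
  openCluster_closeEdges_edgesAt_of_mem hω hk

/-- A pruned cluster of a vertex off the ball misses the ball. [folklore] -/
theorem not_mem_ball_of_mem_openCluster_prunedConfig {ω : BondConfig V} (hω : ω ⊆ G.edgeSet)
    {v a : V} (hv : v ∉ ballVerts G o r) (ha : a ∈ openCluster (prunedConfig G o r ω) v) :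
    a ∉ ballVerts G o r := by
  intro hak
  have : v ∈ openCluster (prunedConfig G o r ω) a := mem_openCluster_comm.1 ha
  rw [openCluster_prunedConfig_of_mem_ball hω hak, Set.mem_singleton_iff] at this
  exact hv (this ▸ hak)

/-- **A pruned cluster off the ball with no sphere vertex is an unchanged cluster of `ω`**, missing
the ball, with the same edges at its vertices (`ω ⊆ E(G)`, `G` connected). [folklore] -/
theorem openCluster_prunedConfig_eq (hconn : G.Connected) {ω : BondConfig V} (hω : ω ⊆ G.edgeSet)
    {v : V} (hv : v ∉ ballVerts G o r)
    (hsph : ∀ s ∈ openCluster (prunedConfig G o r ω) v, s ∉ sphereVerts G o r) :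
    openCluster (prunedConfig G o r ω) v = openCluster ω v ∧
      Disjoint (openCluster ω v) ↑(ballVerts G o r) ∧
      ∀ a ∈ openCluster ω v, ∀ b, a ≠ b → (s(a, b) ∈ ω ↔ s(a, b) ∈ prunedConfig G o r ω) := by
  -- edges of `ω` at vertices of the pruned cluster survive
  have hedge : ∀ a ∈ openCluster (prunedConfig G o r ω) v, ∀ b, s(a, b) ∈ ω → a ≠ b →
      s(a, b) ∈ prunedConfig G o r ω := by
    intro a ha b hab hne
    have hak : a ∉ ballVerts G o r := not_mem_ball_of_mem_openCluster_prunedConfig hω hv ha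
    have hbk : b ∉ ballVerts G o r := fun hbk =>
      hsph a ha (mem_sphereVerts_of_adj hconn hbk hak (hω hab).symm)
    exact mk_mem_prunedConfig hab hak hbk
  have hC : openCluster (prunedConfig G o r ω) v = openCluster ω v := by
    refine Set.Subset.antisymm (openCluster_mono (prunedConfig_subset ω) v) ?_
    refine openCluster_subset_of_forall_mem' (mem_openCluster_self _ v) fun a b _ haS hab hne => ?_
    exact mem_openCluster_of_adj haS (hedge a haS b hab hne) hne
  refine ⟨hC, ?_, fun a ha b hne => ⟨fun hab => hedge a (hC.symm ▸ ha) b hab hne,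
    fun hab => prunedConfig_subset ω hab⟩⟩
  rw [Set.disjoint_left]
  intro a ha hak
  exact not_mem_ball_of_mem_openCluster_prunedConfig hω hv (hC.symm ▸ ha) hak

end Ball

/-! ### The cluster structure after the surgery -/

section Structure

variable {G : SimpleGraph V} [G.LocallyFinite] [DecidableEq V] {o : V} {r : ℕ}

/-- The hypotheses on the tree `T` opened by the surgery: edges of `G`, with endpoints in a set
`VT ⊆ K ∪ ∂K` containing `o` and `T`-connected to `o`. [folklore] -/
structure IsSurgeryTree (G : SimpleGraph V) [G.LocallyFinite] (o : V) (r : ℕ) (T : Set (Sym2 V))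
    (VT : Set V) : Prop where
  subset_edgeSet : T ⊆ G.edgeSet
  mem_of_mem : ∀ z ∈ T, ∀ u ∈ z, u ∈ VT
  subset_ball_sphere : VT ⊆ ↑(ballVerts G o r) ∪ sphereVerts G o r
  base_mem : o ∈ VT
  reachable : ∀ v ∈ VT, (fromEdgeSet T).Reachable o v

variable {T : Set (Sym2 V)} {VT : Set V}

/-- The vertices of `T` lie in the new cluster of `o`. [folklore] -/
theorem IsSurgeryTree.mem_openCluster_surgery (hT : IsSurgeryTree G o r T VT) (ω : BondConfig V)
    {v : V} (hv : v ∈ VT) : v ∈ openCluster (surgery G o r T ω) o := by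
  refine (hT.reachable v hv).mono ?_
  intro a b hab
  rw [fromEdgeSet_adj] at hab
  rw [openGraph_adj]
  exact ⟨subset_surgery T ω hab.1, hab.2⟩

/-- **The new cluster of `o`**: `C_{surgery}(o) = VT ∪ ⋃_{a ∈ VT ∩ ∂K} C_{ω ∖ E_K}(a)`
(`ω ⊆ E(G)`). [cite: Timar2006, Lemma 5.3 (proof: insertion tolerance)] -/
theorem openCluster_surgery_base (hT : IsSurgeryTree G o r T VT) {ω : BondConfig V}
    (hω : ω ⊆ G.edgeSet) :
    openCluster (surgery G o r T ω) o =
      VT ∪ ⋃ a ∈ VT ∩ sphereVerts G o r, openCluster (prunedConfig G o r ω) a := by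
  refine Set.Subset.antisymm ?_ ?_
  · refine openCluster_subset_of_forall_mem' (Or.inl hT.base_mem) fun u c _ hu huc hne => ?_
    rw [mem_surgery_iff] at huc
    rcases huc with huc | huc
    · -- a pruned edge: `u, c` off the ball, in one pruned cluster
      rcases hu with hu | hu
      · have huk : u ∉ ballVerts G o r := fun huk => not_mem_prunedConfig hω huk huc
        have husph : u ∈ sphereVerts G o r := (hT.subset_ball_sphere hu).resolve_left huk
        exact Or.inr (Set.mem_biUnion ⟨hu, husph⟩ (mem_openCluster_of_adj
          (mem_openCluster_self _ u) huc hne))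
      · obtain ⟨a, ha, hua⟩ := Set.mem_iUnion₂.1 hu
        exact Or.inr (Set.mem_biUnion ha (mem_openCluster_of_adj hua huc hne))
    · exact Or.inl (hT.mem_of_mem _ huc c (Sym2.mem_mk_right u c))
  · rintro v (hv | hv)
    · exact hT.mem_openCluster_surgery ω hv
    · obtain ⟨a, ha, hva⟩ := Set.mem_iUnion₂.1 hv
      have hao : openCluster (surgery G o r T ω) a = openCluster (surgery G o r T ω) o :=
        openCluster_eq_openCluster_of_mem (hT.mem_openCluster_surgery ω ha.1)
      rw [← hao]
      exact openCluster_mono (prunedConfig_subset_surgery T ω) a hva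

/-- **The other clusters are pruned clusters**: for `v` outside the new cluster of `o`,
`C_{surgery}(v) = C_{ω ∖ E_K}(v)`, and the surgery has the same edges as `ω ∖ E_K` at its
vertices. [folklore] -/
theorem openCluster_surgery_of_not_mem (hT : IsSurgeryTree G o r T VT) (ω : BondConfig V) {v : V}
    (hv : v ∉ openCluster (surgery G o r T ω) o) :
    openCluster (surgery G o r T ω) v = openCluster (prunedConfig G o r ω) v ∧
      ∀ a ∈ openCluster (surgery G o r T ω) v, ∀ b, a ≠ b →
        (s(a, b) ∈ surgery G o r T ω ↔ s(a, b) ∈ prunedConfig G o r ω) := by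
  have hnotT : ∀ a ∈ openCluster (surgery G o r T ω) v, ∀ b, s(a, b) ∉ T := by
    intro a ha b hab
    have haT : a ∈ VT := hT.mem_of_mem _ hab a (Sym2.mem_mk_left a b)
    have hao := hT.mem_openCluster_surgery ω haT
    exact hv (by rw [← openCluster_eq_openCluster_of_mem hao]; exact mem_openCluster_comm.1 ha)
  have hedges : ∀ a ∈ openCluster (surgery G o r T ω) v, ∀ b, a ≠ b →
      (s(a, b) ∈ surgery G o r T ω ↔ s(a, b) ∈ prunedConfig G o r ω) := by
    intro a ha b _
    rw [mem_surgery_iff]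
    exact ⟨fun h => h.resolve_right (hnotT a ha b), Or.inl⟩
  refine ⟨Set.Subset.antisymm ?_ (openCluster_mono (prunedConfig_subset_surgery T ω) v), hedges⟩
  exact openCluster_subset_of_edges fun a ha b hab hne => (hedges a ha b hne).1 hab

end Structure

/-! ### (S1) The absorbing surgery leaves no bad cluster -/

section Absorb

variable {G : SimpleGraph V} [G.LocallyFinite] [DecidableEq V] {o : V} {r : ℕ}
  {T : Set (Sym2 V)} {VT : Set V}

/-- **(S1) The absorbing surgery leaves no bad cluster.** If the tree reaches every sphere vertex
whose pruned cluster is heavy, every bad cluster of `ω` meets the ball, and the new cluster of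
`o` is not bad, then after the surgery NO cluster is bad (`ω ⊆ E(G)`, `G` connected).
[cite: Timar2006, Thm. 5.5 (proof: the bad clusters) and Lemma 5.3 (insertion tolerance)] -/
theorem not_isBad_surgery (hconn : G.Connected) (hT : IsSurgeryTree G o r T VT) {ω : BondConfig V}
    (hω : ω ⊆ G.edgeSet)
    (hheavy : ∀ s ∈ sphereVerts G o r, IsHeavy G o (openCluster (prunedConfig G o r ω) s) → s ∈ VT)
    (hbad : ∀ x, IsBad G o ω x → ∃ k ∈ ballVerts G o r, k ∈ openCluster ω x)
    (hbase : ¬ IsBad G o (surgery G o r T ω) o) (v : V) : ¬ IsBad G o (surgery G o r T ω) v := by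
  by_cases hv : v ∈ openCluster (surgery G o r T ω) o
  · rwa [isBad_of_mem hv]
  obtain ⟨hC, hedges⟩ := openCluster_surgery_of_not_mem hT ω hv
  -- badness of `v` in the surgery = badness in the pruned configuration
  rw [isBad_congr hedges]
  by_cases hvk : v ∈ ballVerts G o r
  · refine not_isBad_of_not_isHeavy ?_
    rw [openCluster_prunedConfig_of_mem_ball hω hvk]
    exact not_isHeavy_of_finite G hconn o (Set.finite_singleton v)
  by_cases hsph : ∃ s ∈ openCluster (prunedConfig G o r ω) v, s ∈ sphereVerts G o r
  · -- a sphere vertex of the pruned cluster: the cluster is light (else it would be attached)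
    obtain ⟨s, hs, hssph⟩ := hsph
    refine not_isBad_of_not_isHeavy fun hH => hv ?_
    have hsC : openCluster (prunedConfig G o r ω) s = openCluster (prunedConfig G o r ω) v :=
      openCluster_eq_openCluster_of_mem hs
    have hsT : s ∈ VT := hheavy s hssph (hsC ▸ hH)
    have hso := hT.mem_openCluster_surgery ω hsT
    -- `v ~ s` in the pruned configuration, hence in the surgery
    have : v ∈ openCluster (surgery G o r T ω) s :=
      openCluster_mono (prunedConfig_subset_surgery T ω) s (mem_openCluster_comm.1 hs)
    rwa [openCluster_eq_openCluster_of_mem hso] at this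
  · -- no sphere vertex: an unchanged cluster of `ω` missing the ball, hence not bad
    push Not at hsph
    obtain ⟨hC', hdisj, hedges'⟩ := openCluster_prunedConfig_eq hconn hω hvk hsph
    rw [← isBad_congr hedges']
    intro hb
    obtain ⟨k, hk, hkv⟩ := hbad v hb
    exact Set.disjoint_left.1 hdisj hkv hk

/-- **The new cluster of `o` is not bad** as soon as some heavy cluster of `ω` meeting the ball
has an infinite level-piece and the tree reaches every sphere vertex whose pruned cluster is
heavy: the infinite piece survives the pruning inside the cluster of some sphere vertex, which is
then attached. [cite: Timar2006, Thm. 5.5 (proof: bad clusters)] -/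
theorem not_isBad_surgery_base (hconn : G.Connected) (hT : IsSurgeryTree G o r T VT)
    {ω : BondConfig V} (hω : ω ⊆ G.edgeSet)
    (hheavy : ∀ s ∈ sphereVerts G o r, IsHeavy G o (openCluster (prunedConfig G o r ω) s) → s ∈ VT)
    {x y : V} {S : Finset V} (hy : y ∈ openCluster ω x) (hinf : (levelPiece G S ω y).Infinite)
    (hmeet : ∃ k ∈ ballVerts G o r, k ∈ openCluster ω x) :
    ¬ IsBad G o (surgery G o r T ω) o := by
  classical
  -- cover the infinite piece `Q` by the ball and the pruned pieces of finitely many vertices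
  set ω' := prunedConfig G o r ω with hω'
  set K := ballVerts G o r with hKdef
  set Q := levelPiece G S ω y with hQ
  set N : Finset V := insert y (K.biUnion fun k => G.neighborFinset k) with hN
  have hcover : Q ⊆ ↑K ∪ ⋃ z ∈ N, levelPiece G S ω' z := by
    -- closed-set argument in the configuration `ω ∩ E(G[L])`
    refine openCluster_subset_of_forall_mem' ?_ fun a c _ ha hac hne => ?_
    · exact Or.inr (Set.mem_biUnion (Finset.mem_insert_self y _) (mem_openCluster_self _ y))
    by_cases hcK : c ∈ K
    · exact Or.inl hcK
    by_cases haK : a ∈ K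
    · have hadj : G.Adj a c := by
        have := hω hac.1; rwa [SimpleGraph.mem_edgeSet] at this
      have hcN : c ∈ N :=
        Finset.mem_insert_of_mem (Finset.mem_biUnion.2 ⟨a, haK, (G.mem_neighborFinset a c).2 hadj⟩)
      exact Or.inr (Set.mem_biUnion hcN (mem_openCluster_self _ c))
    · rcases ha with haK' | ha
      · exact absurd haK' haK
      · obtain ⟨z, hz, haz⟩ := Set.mem_iUnion₂.1 ha
        refine Or.inr (Set.mem_biUnion hz (mem_openCluster_of_adj haz ⟨?_, hac.2⟩ hne))
        exact mk_mem_prunedConfig hac.1 haK hcK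
  -- some pruned piece is infinite
  obtain ⟨z, hzN, hzinf⟩ : ∃ z ∈ N, (levelPiece G S ω' z ∩ Q).Infinite := by
    by_contra hno
    push Not at hno
    refine hinf ((K.finite_toSet.union (Set.Finite.biUnion N.finite_toSet fun z hz => hno z hz)).subset ?_)
    intro q hq
    rcases hcover hq with h | h
    · exact Or.inl h
    · obtain ⟨z, hz, hqz⟩ := Set.mem_iUnion₂.1 h
      exact Or.inr (Set.mem_biUnion hz ⟨hqz, hq⟩)
  have hzinf' : (levelPiece G S ω' z).Infinite := hzinf.mono Set.inter_subset_left
  -- `z` is off the ball and in the cluster of `x`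
  have hzK : z ∉ K := by
    intro hzK
    refine hzinf' ((Set.finite_singleton z).subset ?_)
    calc levelPiece G S ω' z ⊆ openCluster ω' z := openClusterIn_subset_openCluster _ _ _
      _ = {z} := openCluster_prunedConfig_of_mem_ball hω hzK
  have hzx : z ∈ openCluster ω x := by
    obtain ⟨q, hqz, hqQ⟩ := hzinf.nonempty
    have hqy : q ∈ openCluster ω y := openClusterIn_subset_openCluster _ _ _ hqQ
    have hqz' : q ∈ openCluster ω z :=
      openCluster_mono (prunedConfig_subset ω) z (openClusterIn_subset_openCluster _ _ _ hqz)
    have h1 : z ∈ openCluster ω y := by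
      rw [← openCluster_eq_openCluster_of_mem hqy]; exact mem_openCluster_comm.1 hqz'
    rwa [openCluster_eq_openCluster_of_mem hy] at h1
  -- the pruned cluster `P` of `z` is heavy: it contains an infinite set inside finitely many levels
  set P := openCluster ω' z with hP
  have hPheavy : IsHeavy G o P := by
    have hsub : levelPiece G S ω' z ⊆ P ∩ levelUnion G S := fun q hq =>
      ⟨openClusterIn_subset_openCluster _ _ _ hq, ?_⟩
    · by_contra hlight
      -- a light set meets the finitely many levels of `S` finitely
      have hfin : (P ∩ levelUnion G S).Finite := by
        have : P ∩ levelUnion G S ⊆ ⋃ s ∈ S, P ∩ level G s := by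
          rintro q ⟨hqP, hqL⟩
          obtain ⟨s, hs, hsq⟩ := mem_levelUnion_iff.1 hqL
          exact Set.mem_biUnion hs ⟨hqP, hsq⟩
        exact (Set.Finite.biUnion S.finite_toSet fun s _ => finite_inter_level_of_not_isHeavy hconn hlight s).subset this
      exact hzinf' (hfin.subset hsub)
    · -- the piece stays inside the union of levels (or is `{z}`)
      by_cases hzL : z ∈ levelUnion G S
      · exact openClusterIn_withinGraph_subset hzL _ hq
      · have : levelPiece G S ω' z = {z} := by
          refine Set.Subset.antisymm ?_ (by simp)
          refine openCluster_subset_of_forall_mem' rfl fun a c _ ha hac _ => ?_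
          rw [Set.mem_singleton_iff] at ha; subst ha
          exact absurd hac.2.2.1 hzL
        rw [this, Set.mem_singleton_iff] at hq
        subst hq
        exact absurd (show levelPiece G S ω' q = {q} from this ▸ rfl) fun h => hzinf' (h ▸ Set.finite_singleton q)
  -- `P` contains a sphere vertex (else it is an unchanged cluster of `ω` missing the ball)
  obtain ⟨s, hsP, hssph⟩ : ∃ s ∈ P, s ∈ sphereVerts G o r := by
    by_contra hno
    push Not at hno
    obtain ⟨hC', hdisj, -⟩ := openCluster_prunedConfig_eq hconn hω hzK hno
    obtain ⟨k, hk, hkx⟩ := hmeet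
    have hkz : k ∈ openCluster ω z := by rwa [openCluster_eq_openCluster_of_mem hzx]
    exact Set.disjoint_left.1 hdisj hkz hk
  -- hence `s ∈ VT` and `P ⊆ C_{surgery}(o)`; the infinite piece survives in the surgery
  have hsC : openCluster ω' s = P := openCluster_eq_openCluster_of_mem hsP
  have hsT : s ∈ VT := hheavy s hssph (hsC ▸ hPheavy)
  have hzsurg : z ∈ openCluster (surgery G o r T ω) o := by
    have hz_s : z ∈ openCluster ω' s := mem_openCluster_comm.1 hsP
    have := openCluster_mono (prunedConfig_subset_surgery T ω) s hz_s
    rwa [openCluster_eq_openCluster_of_mem (hT.mem_openCluster_surgery ω hsT)] at this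
  refine not_isBad_of_infinite_levelPiece hzsurg (S := S) (hzinf'.mono ?_)
  exact openClusterIn_mono_config _ (prunedConfig_subset_surgery T ω) z

end Absorb

/-! ### (S2) The tripod surgery produces a bad cluster with an encounter point -/

section TripodSurgery

variable {G : SimpleGraph V} [G.LocallyFinite] [DecidableEq V] {o : V} {r : ℕ}

omit [DecidableEq V] in
/-- **The union of the chains of any set `σ` of sphere vertices (together with `o`) is a surgery
tree** (connected `G`). [folklore] -/
theorem isSurgeryTree_chains (hconn : G.Connected) {σ : Set V} (hσ : σ ⊆ sphereVerts G o r) :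
    IsSurgeryTree G o r (⋃ a ∈ σ, chainEdges hconn o a) ({o} ∪ ⋃ a ∈ σ, chainVerts hconn o a) := by
  have hleg : ∀ {x : V}, x ∈ sphereVerts G o r → ∀ u ∈ chainVerts hconn o x,
      u ∈ (↑(ballVerts G o r) : Set V) ∪ sphereVerts G o r := by
    intro x hx u hu
    have hle := dist_le_of_mem_chainVerts hconn o x hu
    change G.dist o x = r + 1 at hx
    rcases Nat.lt_or_ge (G.dist o u) (r + 1) with h | h
    · exact Or.inl (Finset.mem_coe.2 ((mem_ballVerts_iff hconn).2 (by omega)))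
    · exact Or.inr (show G.dist o u = r + 1 by omega)
  have hreach : ∀ {x : V}, ∀ u ∈ chainVerts hconn o x,
      (fromEdgeSet (chainEdges hconn o x)).Reachable o u := by
    intro x u hu
    obtain ⟨e, he, rfl⟩ := hu
    obtain ⟨p, -⟩ := exists_walk_chain hconn o x he
    obtain ⟨q, -⟩ := exists_walk_chain hconn o x (Nat.zero_le _)
    rw [atDepth_zero] at q
    exact ⟨q.reverse.append p⟩
  have hmono : ∀ {E E' : Set (Sym2 V)}, E ⊆ E' → fromEdgeSet E ≤ fromEdgeSet E' := by
    intro E E' h u v huv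
    rw [fromEdgeSet_adj] at huv ⊢
    exact ⟨h huv.1, huv.2⟩
  refine ⟨?_, ?_, ?_, Or.inl rfl, ?_⟩
  · intro z hz
    obtain ⟨a, ha, hz⟩ := Set.mem_iUnion₂.1 hz
    exact chainEdges_subset_edgeSet hconn o a hz
  · intro z hz u hu
    obtain ⟨a, ha, hz⟩ := Set.mem_iUnion₂.1 hz
    exact Or.inr (Set.mem_biUnion ha (mem_chainVerts_of_mem_chainEdges hconn o a hz hu))
  · rintro u (hu | hu)
    · rw [Set.mem_singleton_iff] at hu; subst hu
      exact Or.inl (Finset.mem_coe.2 ((mem_ballVerts_iff hconn).2 (by rw [dist_self]; exact Nat.zero_le r)))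
    · obtain ⟨a, ha, hu⟩ := Set.mem_iUnion₂.1 hu
      exact hleg (hσ ha) u hu
  · rintro u (hu | hu)
    · rw [Set.mem_singleton_iff] at hu; subst hu; exact Reachable.refl _
    · obtain ⟨a, ha, hu⟩ := Set.mem_iUnion₂.1 hu
      exact (hreach u hu).mono (hmono fun z hz => Set.mem_biUnion ha hz)

omit [G.LocallyFinite] [DecidableEq V] in
/-- Chains are finite; so is any union of chains over a finite set. [folklore] -/
theorem chainVerts_finite (hconn : G.Connected) (x : V) : (chainVerts hconn o x).Finite :=
  ((Set.finite_Iic (G.dist o x)).image (atDepth hconn o x)).subset fun _ ⟨e, he, hu⟩ =>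
    ⟨e, he, hu.symm⟩

omit [G.LocallyFinite] [DecidableEq V] in
/-- The edges of a chain form a finite set. [folklore] -/
theorem chainEdges_finite (hconn : G.Connected) (x : V) : (chainEdges hconn o x).Finite :=
  ((Set.finite_Iio (G.dist o x)).image fun e => s(atDepth hconn o x (e + 1), atDepth hconn o x e)).subset
    fun _ ⟨e, he, hz⟩ => ⟨e, he, hz.symm⟩

omit [DecidableEq V] in
/-- The tripod of three sphere vertices is a surgery tree (connected `G`). [folklore] -/
theorem isSurgeryTree_tripod (hconn : G.Connected) {a b c : V} (ha : a ∈ sphereVerts G o r)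
    (hb : b ∈ sphereVerts G o r) (hc : c ∈ sphereVerts G o r) :
    IsSurgeryTree G o r (tripodEdges hconn o a b c) (tripodVerts hconn o a b c) := by
  have hleg : ∀ {x : V}, x ∈ sphereVerts G o r → ∀ u ∈ chainVerts hconn o x,
      u ∈ (↑(ballVerts G o r) : Set V) ∪ sphereVerts G o r := by
    intro x hx u hu
    have hle := dist_le_of_mem_chainVerts hconn o x hu
    change G.dist o x = r + 1 at hx
    rcases Nat.lt_or_ge (G.dist o u) (r + 1) with h | h
    · exact Or.inl (Finset.mem_coe.2 ((mem_ballVerts_iff hconn).2 (by omega)))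
    · exact Or.inr (show G.dist o u = r + 1 by omega)
  have hreach : ∀ {x : V}, ∀ u ∈ chainVerts hconn o x,
      (fromEdgeSet (chainEdges hconn o x)).Reachable o u := by
    intro x u hu
    obtain ⟨e, he, rfl⟩ := hu
    obtain ⟨p, -⟩ := exists_walk_chain hconn o x he
    obtain ⟨q, -⟩ := exists_walk_chain hconn o x (Nat.zero_le _)
    rw [atDepth_zero] at q
    exact ⟨q.reverse.append p⟩
  have hmono : ∀ {E E' : Set (Sym2 V)}, E ⊆ E' → fromEdgeSet E ≤ fromEdgeSet E' := by
    intro E E' h u v huv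
    rw [fromEdgeSet_adj] at huv ⊢
    exact ⟨h huv.1, huv.2⟩
  refine ⟨tripodEdges_subset_edgeSet hconn o a b c,
    fun z hz u hu => mem_tripodVerts_of_mem_tripodEdges hconn o hz hu, ?_, ?_, ?_⟩
  · rintro u ((hu | hu) | hu)
    · exact hleg ha u hu
    · exact hleg hb u hu
    · exact hleg hc u hu
  · exact Or.inl (Or.inl ⟨0, Nat.zero_le _, (atDepth_zero hconn o a).symm⟩)
  · rintro u ((hu | hu) | hu)
    · exact (hreach u hu).mono (hmono fun z hz => Or.inl (Or.inl hz))
    · exact (hreach u hu).mono (hmono fun z hz => Or.inl (Or.inr hz))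
    · exact (hreach u hu).mono (hmono fun z hz => Or.inr hz)

omit [DecidableEq V] in
/-- Tripod vertices other than the three leaves lie in the ball. [folklore] -/
theorem mem_ball_of_mem_tripodVerts (hconn : G.Connected) {a b c : V} (ha : a ∈ sphereVerts G o r)
    (hb : b ∈ sphereVerts G o r) (hc : c ∈ sphereVerts G o r) {u : V}
    (hu : u ∈ tripodVerts hconn o a b c) (hua : u ≠ a) (hub : u ≠ b) (huc : u ≠ c) :
    u ∈ ballVerts G o r := by
  have key : ∀ {x : V}, x ∈ sphereVerts G o r → u ∈ chainVerts hconn o x → u ≠ x → u ∈ ballVerts G o r := by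
    intro x hx hux hne
    have hle := dist_le_of_mem_chainVerts hconn o x hux
    change G.dist o x = r + 1 at hx
    rw [mem_ballVerts_iff hconn]
    by_contra hgt
    exact hne (eq_of_mem_chainVerts_of_dist_eq hconn o x hux (by omega))
  rcases hu with (hu | hu) | hu
  · exact key ha hu hua
  · exact key hb hu hub
  · exact key hc hu huc

/-- **(S2a) The tripod surgery produces a bad cluster at `o`**: if the pruned clusters of the three
sphere vertices lie in bad clusters of `ω`, the new cluster of `o` is bad (`ω ⊆ E(G)`; it is heavy
because the pruned cluster of `a` is). [cite: Timar2006, Thm. 5.5 (proof: bad clusters)] -/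
theorem isBad_surgery_tripod (hconn : G.Connected) {ω : BondConfig V} (hω : ω ⊆ G.edgeSet)
    {a b c : V} (ha : a ∈ sphereVerts G o r) (hb : b ∈ sphereVerts G o r) (hc : c ∈ sphereVerts G o r)
    (hheavy : IsHeavy G o (openCluster (prunedConfig G o r ω) a))
    (hbad : ∀ x, (x = a ∨ x = b ∨ x = c) → IsBad G o ω x) :
    IsBad G o (surgery G o r (tripodEdges hconn o a b c) ω) o := by
  classical
  set T := tripodEdges hconn o a b c with hTdef
  set VT := tripodVerts hconn o a b c with hVT
  set ω' := prunedConfig G o r ω with hω'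
  have hT : IsSurgeryTree G o r T VT := isSurgeryTree_tripod hconn ha hb hc
  have hVTfin : VT.Finite := by
    have hch : ∀ x : V, (chainVerts hconn o x).Finite := fun x =>
      (Set.finite_Iic (G.dist o x)).image (atDepth hconn o x) |>.subset fun u ⟨e, he, hu⟩ =>
        ⟨e, he, hu.symm⟩
    exact ((hch a).union (hch b)).union (hch c)
  have hbase := openCluster_surgery_base hT hω
  refine ⟨?_, fun S y hy => ?_⟩
  · -- heavy: contains the pruned cluster of `a`
    refine hheavy.mono fun q hq => ?_
    rw [hbase]
    exact Or.inr (Set.mem_biUnion ⟨Or.inl (Or.inl (self_mem_chainVerts hconn o a)), ha⟩ hq)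
  · -- every piece is finite: it is covered by the pruned pieces of `y` and of the tripod vertices
    have hcover : levelPiece G S (surgery G o r T ω) y ⊆
        levelPiece G S ω' y ∪ ⋃ t ∈ VT, levelPiece G S ω' t := by
      refine openCluster_subset_of_forall_mem' (Or.inl (mem_openCluster_self _ y)) ?_
      intro u v _ hu huv hne
      obtain ⟨huv, hL⟩ := huv
      rw [mem_surgery_iff] at huv
      rcases huv with huv | huv
      · rcases hu with hu | hu
        · exact Or.inl (mem_openCluster_of_adj hu ⟨huv, hL⟩ hne)
        · obtain ⟨t, ht, hut⟩ := Set.mem_iUnion₂.1 hu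
          exact Or.inr (Set.mem_biUnion ht (mem_openCluster_of_adj hut ⟨huv, hL⟩ hne))
      · exact Or.inr (Set.mem_biUnion (hT.mem_of_mem _ huv v (Sym2.mem_mk_right u v))
          (mem_openCluster_self _ v))
    -- pruned pieces of vertices of bad clusters (or of the ball) are finite
    have hfin_pruned : ∀ t, (t ∈ ballVerts G o r ∨ ∃ x, (x = a ∨ x = b ∨ x = c) ∧ t ∈ openCluster ω x) →
        (levelPiece G S ω' t).Finite := by
      rintro t (ht | ⟨x, hx, htx⟩)
      · refine (Set.finite_singleton t).subset ?_
        calc levelPiece G S ω' t ⊆ openCluster ω' t := openClusterIn_subset_openCluster _ _ _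
          _ = {t} := openCluster_prunedConfig_of_mem_ball hω ht
      · exact ((hbad x hx).2 S t htx).subset (openClusterIn_mono_config _ (prunedConfig_subset ω) t)
    have hVT_fin : ∀ t ∈ VT, (levelPiece G S ω' t).Finite := by
      intro t ht
      by_cases hta : t = a
      · exact hfin_pruned t (Or.inr ⟨a, Or.inl rfl, hta ▸ mem_openCluster_self ω t⟩)
      by_cases htb : t = b
      · exact hfin_pruned t (Or.inr ⟨b, Or.inr (Or.inl rfl), htb ▸ mem_openCluster_self ω t⟩)
      by_cases htc : t = c
      · exact hfin_pruned t (Or.inr ⟨c, Or.inr (Or.inr rfl), htc ▸ mem_openCluster_self ω t⟩)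
      exact hfin_pruned t (Or.inl (mem_ball_of_mem_tripodVerts hconn ha hb hc ht hta htb htc))
    have hy_fin : (levelPiece G S ω' y).Finite := by
      rw [hbase] at hy
      rcases hy with hy | hy
      · exact hVT_fin y hy
      · obtain ⟨t, ⟨htT, htsph⟩, hyt⟩ := Set.mem_iUnion₂.1 hy
        -- `t` is a leaf (sphere vertex of the tripod), `y` in its pruned cluster ⊆ bad cluster
        have htabc : t = a ∨ t = b ∨ t = c := by
          by_contra hno
          push Not at hno
          exact not_mem_ballVerts_of_mem_sphereVerts hconn htsph
            (mem_ball_of_mem_tripodVerts hconn ha hb hc htT hno.1 hno.2.1 hno.2.2)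
        refine hfin_pruned y (Or.inr ⟨t, htabc, ?_⟩)
        exact openCluster_mono (prunedConfig_subset ω) t hyt
    exact (hy_fin.union (Set.Finite.biUnion hVTfin hVT_fin)).subset hcover

/-- **(S2b) The median of the tripod is an encounter point after the surgery**: if moreover the
pruned clusters of `a, b, c` are heavy and pairwise distinct, the separating vertex `m` of
`exists_median_separates` has three heavy branches in the new configuration.
[cite: Timar2006, Lemma 5.3 (proof: the existence of encounter points follows from insertion tolerance)] -/
theorem isEncounter_surgery_tripod (hconn : G.Connected) {ω : BondConfig V} (hω : ω ⊆ G.edgeSet)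
    {a b c : V} (ha : a ∈ sphereVerts G o r) (hb : b ∈ sphereVerts G o r) (hc : c ∈ sphereVerts G o r)
    (hab : a ≠ b) (hac : a ≠ c) (hbc : b ≠ c)
    (hheavy : ∀ x, (x = a ∨ x = b ∨ x = c) → IsHeavy G o (openCluster (prunedConfig G o r ω) x))
    (hdistinct : ∀ x y, (x = a ∨ x = b ∨ x = c) → (y = a ∨ y = b ∨ y = c) → x ≠ y →
      y ∉ openCluster (prunedConfig G o r ω) x) :
    ∃ m ∈ ballVerts G o r, m ∈ openCluster (surgery G o r (tripodEdges hconn o a b c) ω) o ∧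
      IsEncounter G o (surgery G o r (tripodEdges hconn o a b c) ω) m := by
  classical
  set T := tripodEdges hconn o a b c with hTdef
  set VT := tripodVerts hconn o a b c with hVT
  set ω' := prunedConfig G o r ω with hω'
  set ωs := surgery G o r T ω with hωs
  have hT : IsSurgeryTree G o r T VT := isSurgeryTree_tripod hconn ha hb hc
  obtain ⟨m, hmT, hmR, hmab, hmac, hmbc⟩ := exists_median_separates (hconn := hconn) (o := o)
    (a := a) (b := b) (c := c) (R := r + 1) ha hb hc hab hac hbc
  have hma : m ≠ a := fun h => by rw [h] at hmR; change G.dist o a = r + 1 at ha; omega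
  have hmb : m ≠ b := fun h => by rw [h] at hmR; change G.dist o b = r + 1 at hb; omega
  have hmc : m ≠ c := fun h => by rw [h] at hmR; change G.dist o c = r + 1 at hc; omega
  have hmK : m ∈ ballVerts G o r := mem_ball_of_mem_tripodVerts hconn ha hb hc hmT hma hmb hmc
  refine ⟨m, hmK, hT.mem_openCluster_surgery ω hmT, ?_⟩
  -- general separation: the branch side of a leaf `x` at `m`
  have hleaf_sph : ∀ {x}, (x = a ∨ x = b ∨ x = c) → x ∈ sphereVerts G o r := by
    rintro x (rfl | rfl | rfl) <;> assumption
  have hVT_cases : ∀ t ∈ VT, t ∈ ballVerts G o r ∨ (t = a ∨ t = b ∨ t = c) := by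
    intro t ht
    by_cases hta : t = a; · exact Or.inr (Or.inl hta)
    by_cases htb : t = b; · exact Or.inr (Or.inr (Or.inl htb))
    by_cases htc : t = c; · exact Or.inr (Or.inr (Or.inr htc))
    exact Or.inl (mem_ball_of_mem_tripodVerts hconn ha hb hc ht hta htb htc)
  -- closed set: the tripod-avoid-component of `x` together with the pruned clusters of its leaves
  have hsep : ∀ x y, (x = a ∨ x = b ∨ x = c) → (y = a ∨ y = b ∨ y = c) → x ≠ y →
      ¬ AvoidReach (fromEdgeSet T) m x y → ¬ AvoidReach (openGraph ωs) m x y := by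
    intro x y hx hy hxy hTsep hreach
    set S : Set V := {v | AvoidReach (fromEdgeSet T) m x v} ∪
      ⋃ t ∈ {t | AvoidReach (fromEdgeSet T) m x t ∧ (t = a ∨ t = b ∨ t = c)}, openCluster ω' t with hS
    have hxm : x ≠ m := by rintro rfl; exact (hleaf_sph hx |> not_mem_ballVerts_of_mem_sphereVerts hconn) hmK
    have hxS : x ∈ S := Or.inl (AvoidReach.refl hxm)
    have hclosed : ∀ u w, u ∈ S → (openGraph ωs).Adj u w → w ≠ m → w ∈ S := by
      intro u w hu hadj hwm
      rw [openGraph_adj, hωs, mem_surgery_iff] at hadj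
      obtain ⟨huw | huw, hne⟩ := hadj
      · -- a pruned edge: `u, w` in one pruned cluster, `u` off the ball
        have huK : u ∉ ballVerts G o r := fun huK => not_mem_prunedConfig hω huK huw
        rcases hu with hu | hu
        · -- `u` in the avoid-component is a tripod vertex off the ball: a leaf
          have huVT : u ∈ VT := by
            obtain ⟨p⟩ := hu.reachable.symm
            cases p with
            | nil =>
              rcases hx with rfl | rfl | rfl
              · exact Or.inl (Or.inl (self_mem_chainVerts hconn o _))
              · exact Or.inl (Or.inr (self_mem_chainVerts hconn o _))
              · exact Or.inr (self_mem_chainVerts hconn o _)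
            | cons h _ =>
              rw [fromEdgeSet_adj] at h
              exact hT.mem_of_mem _ h.1 _ (Sym2.mem_mk_left _ _)
          have huleaf : u = a ∨ u = b ∨ u = c := (hVT_cases u huVT).resolve_left huK
          exact Or.inr (Set.mem_biUnion ⟨hu, huleaf⟩
            (mem_openCluster_of_adj (mem_openCluster_self _ u) huw hne))
        · obtain ⟨t, ht, hut⟩ := Set.mem_iUnion₂.1 hu
          exact Or.inr (Set.mem_biUnion ht (mem_openCluster_of_adj hut huw hne))
      · -- a tripod edge: both endpoints are tripod vertices
        have hadjT : (fromEdgeSet T).Adj u w := by rw [fromEdgeSet_adj]; exact ⟨huw, hne⟩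
        rcases hu with hu | hu
        · exact Or.inl (hu.trans ⟨Walk.cons hadjT Walk.nil, by
            simp only [Walk.support_cons, Walk.support_nil, List.mem_cons, List.not_mem_nil,
              or_false, not_or]
            exact ⟨fun h => hu.ne_right h.symm, fun h => hwm h.symm⟩⟩)
        · obtain ⟨t, ⟨htx, htleaf⟩, hut⟩ := Set.mem_iUnion₂.1 hu
          -- `u ∈ VT ∩ C_{ω'}(t)`: off the ball, hence a leaf, hence `u = t`
          have huVT : u ∈ VT := hT.mem_of_mem _ huw u (Sym2.mem_mk_left u w)
          have htK : t ∉ ballVerts G o r := not_mem_ballVerts_of_mem_sphereVerts hconn (hleaf_sph htleaf)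
          have huK : u ∉ ballVerts G o r := not_mem_ball_of_mem_openCluster_prunedConfig hω htK hut
          have huleaf : u = a ∨ u = b ∨ u = c := (hVT_cases u huVT).resolve_left huK
          have hut' : u = t := by
            by_contra hne'
            exact hdistinct t u htleaf huleaf (Ne.symm hne') hut
          subst hut'
          exact Or.inl (htx.trans ⟨Walk.cons hadjT Walk.nil, by
            simp only [Walk.support_cons, Walk.support_nil, List.mem_cons, List.not_mem_nil,
              or_false, not_or]
            exact ⟨fun h => htx.ne_right h.symm, fun h => hwm h.symm⟩⟩)
    have hyS : y ∈ S := hreach.mem_of_closed hclosed hxS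
    rcases hyS with hyS | hyS
    · exact hTsep hyS
    · obtain ⟨t, ⟨htx, htleaf⟩, hyt⟩ := Set.mem_iUnion₂.1 hyS
      by_cases hty : t = y
      · subst hty; exact hTsep htx
      · exact hdistinct t y htleaf hy hty hyt
  -- the three branches
  refine ⟨![a, b, c], fun i => ?_, fun i j hij => ?_, fun i => ?_⟩
  · have hmo : m ∈ openCluster ωs o := hT.mem_openCluster_surgery ω hmT
    rw [openCluster_eq_openCluster_of_mem hmo]
    fin_cases i
    · exact hT.mem_openCluster_surgery ω (Or.inl (Or.inl (self_mem_chainVerts hconn o a)))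
    · exact hT.mem_openCluster_surgery ω (Or.inl (Or.inr (self_mem_chainVerts hconn o b)))
    · exact hT.mem_openCluster_surgery ω (Or.inr (self_mem_chainVerts hconn o c))
  · fin_cases i <;> fin_cases j
    · rfl
    · exact absurd hij (hsep a b (Or.inl rfl) (Or.inr (Or.inl rfl)) hab hmab)
    · exact absurd hij (hsep a c (Or.inl rfl) (Or.inr (Or.inr rfl)) hac hmac)
    · exact absurd hij.symm (hsep a b (Or.inl rfl) (Or.inr (Or.inl rfl)) hab hmab)
    · rfl
    · exact absurd hij (hsep b c (Or.inr (Or.inl rfl)) (Or.inr (Or.inr rfl)) hbc hmbc)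
    · exact absurd hij.symm (hsep a c (Or.inl rfl) (Or.inr (Or.inr rfl)) hac hmac)
    · exact absurd hij.symm (hsep b c (Or.inr (Or.inl rfl)) (Or.inr (Or.inr rfl)) hbc hmbc)
    · rfl
  · -- the branch of the leaf `x` at `m` contains its heavy pruned cluster
    have key : ∀ x, (x = a ∨ x = b ∨ x = c) → IsHeavy G o (branchSet ωs m x) := by
      intro x hx
      refine (hheavy x hx).mono fun q hq => ?_
      -- an `ω'`-walk from `x` to `q` avoids `m` (it stays off the ball)
      obtain ⟨p⟩ := (show (openGraph ω').Reachable x q from hq)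
      have hxK : x ∉ ballVerts G o r := not_mem_ballVerts_of_mem_sphereVerts hconn (hleaf_sph hx)
      have hsupp : ∀ v ∈ p.support, v ∈ openCluster ω' x := fun v hv =>
        ⟨p.takeUntil v hv⟩
      have hle : openGraph ω' ≤ openGraph ωs := fromEdgeSet_mono (prunedConfig_subset_surgery T ω)
      refine ⟨p.mapLe hle, ?_⟩
      rw [Walk.support_mapLe_eq_support]
      intro hm
      exact not_mem_ball_of_mem_openCluster_prunedConfig hω hxK (hsupp _ hm) hmK
    fin_cases i
    · exact key a (Or.inl rfl)
    · exact key b (Or.inr (Or.inl rfl))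
    · exact key c (Or.inr (Or.inr rfl))

end TripodSurgery

end Literature.Barriers.CriticalPhenomena

end
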